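import Summits.QuantumFields.BalabanUV.Beta.EriceRemainderEnclosureHistoryAutonomyComparisonNonlinearRowPrep

/-!
# EriceRemainderEnclosureHistoryAutonomyComparisonNonlinearMarkovPrep — (E122b) THE DAMPING DEFECT WITH A MARKOV WEIGHT: (E118a) `pinSens_le` ∕ `conf_incr_ge` WITHOUT the
# hypothesis `L_0 = 0`.  Base `B u = β₀ + Σ_{k<K} L_k·u_k` (`β₀ > 0`, `L ≥ 0`, the newest-entry = MARKOV weight `L_0 ≥ 0` now ALLOWED); `B′` isotone with floor, modulus,
# unique solutions, and an excess `B′ − B` of modulus `ME ≥ 0` along ordered pairs.  The `k = 0` term of the affine profile is read at the two PINS themselves, `L_0·(q −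
# q′) ≤ L_0·(q³∕2)·(1∕q′² − 1∕q²)`, so it simply joins the excess modulus: **`pinSens_le_markov`** — `B′(S′q) − B′(S′q′) ≤ (Σ_{1≤k<K} L_k(S q)_k³∕2 + (L_0 + ME)·q³∕2)·δ`;
# **`conf_incr_ge_markov`** — within a configuration `δ_k − δ_{k+1} ≤ (F(m) + (L_0 + ME)·h_m³∕2)·δ_k`.  With the generic row ∕ step ∕ base of (E121c), (E121d), (E122a) —
# all free of `L_0 = 0` — the sequel (E122c) runs the level-gauge induction: COMPARISON AT ANY SIZE WITH A SMALL MARKOV RIDER, `(L_0 + ME)·γ ≤ β₀∕5`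
# (`HOME/b2b-balaban-beta-d4-p2/g98/README.md` §4 (2), the cheap case; an arbitrary `L_0` needs the damped sandwich).

Cell `pub-balaban`, β-function sub-cell, BINDER row D4 «RemainderConst leaves for Bałaban's split» (`HOME/BINDER-OWNERS.md`; owner lineage `b2b-balaban-beta-an4`;
this file by co-owner #2 lineage `b2b-balaban-beta-d4-p2`, generation 99), β-FLOW TEAM duty (1), FREEZE (0) honoured (def-free; imports (E118a) and re-runs two of its
proofs with the `k = 0` term kept; uses (E63a) `levelGap_le_pin_gap`, (E48a) `family_mem` ∕ `family_tail_eq` ∕ `le_of_pin_le` ∕ `strictAnti_of_memFlow`, node U2's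
`Sharpness.abs_sub_le_half_cube_mul` BY NAME; nothing restated).

HONEST FRAMING (page 1, verbatim and binding).  *"Discharging BetaPertH makes Bałaban's UV stability UNCONDITIONAL — a real constructive-QFT result; it is
NOT the continuum limit and NOT the Clay problem."*  THIS FILE DISCHARGES NOTHING OF THE KIND.  Elementary real analysis about ABSTRACT functionals on a box
]0,γ]^ℕ with displayed floors, moduli, profiles and signs — hypotheses of a census, not facts; the form, signs, ages and moments of Bałaban's (1.22) limit
functional are NOT PRINTED ([I] p. 298; GAPS G-t4-U2-1∕-2) and NOT asserted.  Row D4 class UNCHANGED (critical-path width 0; instance 0∕1; D4 DISCHARGE NO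
DATE).  HONEST DEPENDENCY: continuum YM on T⁴ ⇐ BetaPertH ∧ nine spine estimates (0/9 proved); BetaPertH ⇐ (D1) ∧ (D4) ∧ CAP+tail; G-an2-4 gates asym, D1
and NE2/3/4.  NOT CLAIMED here: the comparison theorem (sequel); anything printed — NOT B12 Thm 2, NOT BetaPertH, NOT continuum, NOT Clay.

WHAT IS PROVED ([folklore]; 0 `def`, 0 sorry).  **`pinSens_le_markov`**, **`conf_incr_ge_markov`**.
-/
noncomputable section
open Finset Set

namespace Summit.QuantumFields.BalabanUV.Beta.EriceRemainderEnclosureHistoryAutonomyComparisonNonlinearMarkovPrep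

open Literature.MathematicalPhysics.QuantumFieldTheory.Balaban1983to89
open Literature.MathematicalPhysics.QuantumFieldTheory.Balaban1983to89.T4BetaStationary
open Literature.MathematicalPhysics.QuantumFieldTheory.Balaban1983to89.T4BetaFlowWellPosed
open Literature.MathematicalPhysics.QuantumFieldTheory.Balaban1983to89.T4BetaFlowWellPosed.Sharpness (abs_sub_le_half_cube_mul)
open Summit.QuantumFields.BalabanUV.Beta.EriceRemainderEnclosureHistoryAutonomyOrder
  (family_mem family_tail_eq family_zero le_of_pin_le strictAnti_of_memFlow)
open Summit.QuantumFields.BalabanUV.Beta.EriceRemainderEnclosureHistoryAutonomyComparisonDropBound (levelGap_le_pin_gap)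
open Summit.QuantumFields.BalabanUV.Beta.EriceRemainderEnclosureHistoryAutonomyComparisonNonlinearRowPrep (inv_sqrt_facts sum_range_eq_Ico_of_zero)

variable {B B' : (ℕ → ℝ) → ℝ} {γ β₀ b' M' ME : ℝ} {L : ℕ → ℝ} {K : ℕ} {S S' : ℝ → ℕ → ℝ}

/-! ## §1 Pin sensitivity and damping defect with the Markov weight -/

/-- **THE PIN SENSITIVITY OF THE PERTURBED EFFECTIVE β-FUNCTION WITH A MARKOV WEIGHT** — (E118a) `pinSens_le` without `L_0 = 0`: the `k = 0` term of the affine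
profile reads the PIN GAP itself, `L_0·(q − q′) ≤ L_0·(q³∕2)·(1∕q′² − 1∕q²)`, and joins the excess modulus: `B′(S′q) − B′(S′q′) ≤ (Σ_{1≤k<K} L_k(S q)_k³∕2 + (L_0 +
ME)·q³∕2)·(1∕q′² − 1∕q²)` for pins `0 < q′ ≤ q ≤ γ` with `q` compared. [folklore] -/
theorem pinSens_le_markov (hBaff : ∀ u, SeqBox γ u → B u = β₀ + ∑ k ∈ range K, L k * u k) (hL : ∀ k, 0 ≤ L k)
    (hmono' : ∀ u v : ℕ → ℝ, SeqBox γ u → SeqBox γ v → (∀ j, u j ≤ v j) → B' u ≤ B' v) (hb' : 0 < b')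
    (hB' : ∀ u u' : ℕ → ℝ, SeqBox γ u → SeqBox γ u' → ∀ D : ℝ, (∀ j, |u j - u' j| ≤ D) → |B' u - B' u'| ≤ M' * D) (hM' : 0 ≤ M')
    (hlo' : ∀ u, SeqBox γ u → b' ≤ B' u)
    (hEmod : ∀ u u' : ℕ → ℝ, SeqBox γ u → SeqBox γ u' → (∀ j, u' j ≤ u j) → ∀ D : ℝ, 0 ≤ D → (∀ j, u j - u' j ≤ D) →
      (B' u - B u) - (B' u' - B u') ≤ ME * D)
    (hS : ∀ p, 0 < p → p ≤ γ → SeqBox γ (S p) ∧ MemFlow B p (S p))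
    (hS' : ∀ p, 0 < p → p ≤ γ → SeqBox γ (S' p) ∧ MemFlow B' p (S' p))
    (huniq' : ∀ p, 0 < p → p ≤ γ → ∀ u u' : ℕ → ℝ, SeqBox γ u → SeqBox γ u' → MemFlow B' p u → MemFlow B' p u' → u = u')
    {q q' : ℝ} (hq' : 0 < q') (hq'q : q' ≤ q) (hqγ : q ≤ γ) (hcmp : ∀ j, S' q j ≤ S q j) :
    B' (S' q) - B' (S' q') ≤ (∑ k ∈ Ico 1 K, L k * S q k ^ 3 / 2 + (L 0 + ME) * q ^ 3 / 2) * (1 / q' ^ 2 - 1 / q ^ 2) := by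
  have hq : 0 < q := hq'.trans_le hq'q
  have hq'γ : q' ≤ γ := hq'q.trans hqγ
  obtain ⟨hk, hfk⟩ := hS' q hq hqγ
  obtain ⟨hk', hfk'⟩ := hS' q' hq' hq'γ
  have hkS : SeqBox γ (S q) := (hS q hq hqγ).1
  set δ : ℝ := 1 / q' ^ 2 - 1 / q ^ 2 with hδ_def
  have hδ0 : 0 ≤ δ := sub_nonneg.mpr (one_div_le_one_div_of_le (pow_pos hq' 2) (pow_le_pow_left₀ hq'.le hq'q 2))
  -- the two B′-solutions are ordered, their level gaps are ≤ δ, their coupling gaps ≤ (S q j)³/2 · δ ≤ q³/2 · δ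
  have hle : ∀ j, S' q' j ≤ S' q j := fun j => le_of_pin_le hb' hB' hM' hlo' huniq' hq' hq'q hqγ hk' hk hfk' hfk j
  have hlg : ∀ j, 1 / S' q' j ^ 2 - 1 / S' q j ^ 2 ≤ δ := levelGap_le_pin_gap hmono' hk hfk hk' hfk' hle
  have hgap : ∀ j, S' q j - S' q' j ≤ S' q j ^ 3 / 2 * δ := by
    intro j
    have h1 := (hk j).1; have h2 := (hk' j).1
    have hw := abs_sub_le_half_cube_mul h1 h2 le_rfl (hle j)
    have hg0 : 0 ≤ S' q j - S' q' j := by linarith [hle j]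
    have hd0 : 0 ≤ 1 / S' q' j ^ 2 - 1 / S' q j ^ 2 :=
      sub_nonneg.mpr (one_div_le_one_div_of_le (pow_pos h2 2) (pow_le_pow_left₀ h2.le (hle j) 2))
    rw [abs_of_nonneg hg0, abs_sub_comm, abs_of_nonneg hd0] at hw
    exact hw.trans (mul_le_mul_of_nonneg_left (hlg j) (by positivity))
  have hpin : ∀ j, S' q j ≤ q := fun j => by
    have := (strictAnti_of_memFlow hb' hlo' hk hfk).antitone (Nat.zero_le j); rwa [hfk.1] at this
  have hgapq : ∀ j, S' q j - S' q' j ≤ q ^ 3 / 2 * δ := fun j =>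
    (hgap j).trans (mul_le_mul_of_nonneg_right (by
      have := pow_le_pow_left₀ (hk j).1.le (hpin j) 3; linarith) hδ0)
  -- the B-part, read through the affine profile on the base orbit; the k = 0 term is the Markov weight times the pin gap
  have hpin0 : S' q 0 = q := hfk.1
  have hpin0' : S' q' 0 = q' := hfk'.1
  have hterm : ∀ k, L k * S' q k - L k * S' q' k ≤ L k * S' q k ^ 3 / 2 * δ := fun k => by
    calc L k * S' q k - L k * S' q' k = L k * (S' q k - S' q' k) := by ring
      _ ≤ L k * (S' q k ^ 3 / 2 * δ) := mul_le_mul_of_nonneg_left (hgap k) (hL k)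
      _ = L k * S' q k ^ 3 / 2 * δ := by ring
  have hBpart : B (S' q) - B (S' q') ≤ (L 0 * q ^ 3 / 2 + ∑ k ∈ Ico 1 K, L k * S q k ^ 3 / 2) * δ := by
    rw [hBaff _ hk, hBaff _ hk', add_sub_add_left_eq_sub, ← sum_sub_distrib]
    cases K with
    | zero =>
      rw [range_zero, sum_empty, Finset.Ico_eq_empty (by omega), sum_empty, add_zero]
      exact mul_nonneg (by have := hL 0; positivity) hδ0
    | succ K' =>
      rw [range_eq_Ico, sum_eq_sum_Ico_succ_bot (by omega), hpin0, hpin0', add_mul, sum_mul]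
      refine add_le_add ?_ (sum_le_sum fun k _ => ?_)
      · have := hterm 0
        rw [hpin0, hpin0'] at this
        linarith
      · have h3 : S' q k ^ 3 ≤ S q k ^ 3 := pow_le_pow_left₀ (hk k).1.le (hcmp k) 3
        calc L k * S' q k - L k * S' q' k ≤ L k * S' q k ^ 3 / 2 * δ := hterm k
          _ ≤ L k * S q k ^ 3 / 2 * δ := mul_le_mul_of_nonneg_right (by nlinarith [hL k]) hδ0
  -- the excess part
  have hEpart : (B' (S' q) - B (S' q)) - (B' (S' q') - B (S' q')) ≤ ME * (q ^ 3 / 2 * δ) :=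
    hEmod _ _ hk hk' hle _ (by positivity) hgapq
  have : B' (S' q) - B' (S' q') = (B (S' q) - B (S' q')) + ((B' (S' q) - B (S' q)) - (B' (S' q') - B (S' q'))) := by ring
  rw [this]
  have e : (∑ k ∈ Ico 1 K, L k * S q k ^ 3 / 2 + (L 0 + ME) * q ^ 3 / 2) * δ
      = (L 0 * q ^ 3 / 2 + ∑ k ∈ Ico 1 K, L k * S q k ^ 3 / 2) * δ + ME * (q ^ 3 / 2 * δ) := by ring
  rw [e]
  exact add_le_add hBpart hEpart

/-- **THE DAMPING DEFECT WITH A MARKOV WEIGHT** — (E118a) `conf_incr_ge` without `L_0 = 0`: configuration `c`, depth `k`, `m = c+1+k`; comparison in configuration `c`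
and from the pin `h_m`, `X_m ≥ 0`; then `δ_k − δ_{k+1} ≤ (Σ_{1≤q<K} L_q·h_{m+q}³∕2 + (L_0 + ME)·h_m³∕2)·δ_k` (`pinSens_le_markov`). [folklore] -/
theorem conf_incr_ge_markov (hBaff : ∀ u, SeqBox γ u → B u = β₀ + ∑ k ∈ range K, L k * u k) (hL : ∀ k, 0 ≤ L k)
    (hmono' : ∀ u v : ℕ → ℝ, SeqBox γ u → SeqBox γ v → (∀ j, u j ≤ v j) → B' u ≤ B' v) (hb' : 0 < b')
    (hB' : ∀ u u' : ℕ → ℝ, SeqBox γ u → SeqBox γ u' → ∀ D : ℝ, (∀ j, |u j - u' j| ≤ D) → |B' u - B' u'| ≤ M' * D) (hM' : 0 ≤ M')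
    (hlo' : ∀ u, SeqBox γ u → b' ≤ B' u)
    (hEmod : ∀ u u' : ℕ → ℝ, SeqBox γ u → SeqBox γ u' → (∀ j, u' j ≤ u j) → ∀ D : ℝ, 0 ≤ D → (∀ j, u j - u' j ≤ D) →
      (B' u - B u) - (B' u' - B u') ≤ ME * D) (hME : 0 ≤ ME)
    (hS : ∀ p, 0 < p → p ≤ γ → SeqBox γ (S p) ∧ MemFlow B p (S p))
    (huniq : ∀ p, 0 < p → p ≤ γ → ∀ u u' : ℕ → ℝ, SeqBox γ u → SeqBox γ u' → MemFlow B p u → MemFlow B p u' → u = u')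
    (hS' : ∀ p, 0 < p → p ≤ γ → SeqBox γ (S' p) ∧ MemFlow B' p (S' p))
    (huniq' : ∀ p, 0 < p → p ≤ γ → ∀ u u' : ℕ → ℝ, SeqBox γ u → SeqBox γ u' → MemFlow B' p u → MemFlow B' p u' → u = u')
    {y : ℝ} (hy : 0 < y) (hyγ : y ≤ γ) (c k : ℕ) (hcmpc : ∀ j, S' (S y c) j ≤ S y (c + j))
    (hcmpm : ∀ j, S' (S y (c + 1 + k)) j ≤ S y (c + 1 + k + j)) (hXm : 0 ≤ B' (S' (S y (c + 1 + k))) - B (S (S y (c + 1 + k)))) :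
    (1 / S' (S y c) k ^ 2 - 1 / S y (c + k) ^ 2) - (1 / S' (S y c) (k + 1) ^ 2 - 1 / S y (c + k + 1) ^ 2)
      ≤ (∑ q ∈ Ico 1 K, L q * S y (c + 1 + k + q) ^ 3 / 2 + (L 0 + ME) * S y (c + 1 + k) ^ 3 / 2)
          * (1 / S' (S y c) k ^ 2 - 1 / S y (c + k) ^ 2) := by
  have hqc := family_mem hS hy hyγ c
  have hqm := family_mem hS hy hyγ (c + 1 + k)
  have hw := hS' _ hqc.1 hqc.2
  have hwk := family_mem hS' hqc.1 hqc.2 (k + 1)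
  have hf := (hS y hy hyγ).2
  -- the increment of the configuration's level gap is X − PS′, exactly
  have e1 : 1 / S' (S y c) (k + 1) ^ 2 = 1 / S' (S y c) k ^ 2 + B' (S' (S' (S y c) (k + 1))) := by
    rw [← family_tail_eq hS' huniq' hqc.1 hqc.2 (k + 1), hw.2.2 k]
  have e2 : 1 / S y (c + k + 1) ^ 2 = 1 / S y (c + k) ^ 2 + B (S (S y (c + 1 + k))) := by
    rw [← family_tail_eq hS huniq hy hyγ (c + 1 + k), hf.2 (c + k), show c + k + 1 = c + 1 + k by ring]
  set δk : ℝ := 1 / S' (S y c) k ^ 2 - 1 / S y (c + k) ^ 2 with hδk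
  set θ : ℝ := ∑ q ∈ Ico 1 K, L q * S y (c + 1 + k + q) ^ 3 / 2 + (L 0 + ME) * S y (c + 1 + k) ^ 3 / 2 with hθ
  have hθ0 : 0 ≤ θ := by
    have : ∀ q, 0 ≤ L q * S y (c + 1 + k + q) ^ 3 / 2 := fun q => by
      have := hL q; have := (family_mem hS hy hyγ (c + 1 + k + q)).1; positivity
    exact add_nonneg (sum_nonneg fun q _ => this q) (by have := hqm.1; have := hME; have := hL 0; positivity)
  have hδk0 : 0 ≤ δk := sub_nonneg.mpr (one_div_le_one_div_of_le (pow_pos (family_mem hS' hqc.1 hqc.2 k).1 2)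
    (pow_le_pow_left₀ (family_mem hS' hqc.1 hqc.2 k).1.le (hcmpc k) 2))
  -- the pin sensitivity between S′(h_c)_{k+1} ≤ h_{c+1+k}
  have hq'q : S' (S y c) (k + 1) ≤ S y (c + 1 + k) := by have := hcmpc (k + 1); rwa [show c + (k + 1) = c + 1 + k by ring] at this
  have etail : ∀ q, S y (c + 1 + k + q) = S (S y (c + 1 + k)) q := fun q => congrFun (family_tail_eq hS huniq hy hyγ (c + 1 + k)) q
  have hcmpm' : ∀ j, S' (S y (c + 1 + k)) j ≤ S (S y (c + 1 + k)) j := fun j => by rw [← etail j]; exact hcmpm j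
  have hps := pinSens_le_markov hBaff hL hmono' hb' hB' hM' hlo' hEmod hS hS' huniq' hwk.1 hq'q hqm.2 hcmpm'
  simp only [← etail] at hps
  -- δ_{k+1} = δ_k + X − PS′ and PS′ ≤ θ·δ_{k+1}
  have hX := hXm
  have key : (1 / S' (S y c) (k + 1) ^ 2 - 1 / S y (c + k + 1) ^ 2)
      = δk + (B' (S' (S y (c + 1 + k))) - B (S (S y (c + 1 + k))))
          - (B' (S' (S y (c + 1 + k))) - B' (S' (S' (S y c) (k + 1)))) := by rw [e1, e2, hδk]; ring
  have hgap' : 1 / S' (S y c) (k + 1) ^ 2 - 1 / S y (c + 1 + k) ^ 2 = 1 / S' (S y c) (k + 1) ^ 2 - 1 / S y (c + k + 1) ^ 2 := by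
    rw [show c + 1 + k = c + k + 1 by ring]
  rw [hgap'] at hps
  -- ε(1+θ) ≥ X − θ δ_k ≥ −θ δ_k
  set ε : ℝ := (1 / S' (S y c) (k + 1) ^ 2 - 1 / S y (c + k + 1) ^ 2) - δk with hε
  have h1 : -(θ * δk) ≤ ε * (1 + θ) := by
    have : ε = (B' (S' (S y (c + 1 + k))) - B (S (S y (c + 1 + k))))
        - (B' (S' (S y (c + 1 + k))) - B' (S' (S' (S y c) (k + 1)))) := by rw [hε, key]; ring
    have hps' : B' (S' (S y (c + 1 + k))) - B' (S' (S' (S y c) (k + 1))) ≤ θ * (δk + ε) := by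
      have : 1 / S' (S y c) (k + 1) ^ 2 - 1 / S y (c + k + 1) ^ 2 = δk + ε := by rw [hε]; ring
      rw [← this]; exact hps
    nlinarith
  have goal : δk - (δk + ε) ≤ θ * δk := by
    by_cases hε0 : 0 ≤ ε
    · nlinarith
    · have hε0 := lt_of_not_ge hε0; nlinarith
  have e3 : 1 / S' (S y c) (k + 1) ^ 2 - 1 / S y (c + k + 1) ^ 2 = δk + ε := by rw [hε]; ring
  rw [e3]; exact goal

end Summit.QuantumFields.BalabanUV.Beta.EriceRemainderEnclosureHistoryAutonomyComparisonNonlinearMarkovPrep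

end
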